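import Summits.ResolutionOfSingularities.ResolutionOfSingularities.Theorems.FrobeniusLadderFInjectiveMacaulayficationT4PlusStalkData
import Summits.ResolutionOfSingularities.ResolutionOfSingularities.Theorems.FrobeniusLadderFInjectiveMacaulayficationCIChartCore
import Summits.ResolutionOfSingularities.ResolutionOfSingularities.Theorems.FrobeniusLadderFInjectiveMacaulayficationFiLocusOpenOfAffine
import Summits.ResolutionOfSingularities.ResolutionOfSingularities.Theorems.FrobeniusLadderFInjectiveMacaulayficationQuotientOriginMaximal
import Mathlib.RingTheory.RegularLocalRing.Polynomial
import HarnessLib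

/-!
# `T⁽⁴⁾⁺` is Cohen–Macaulay at every closed point, and its origin is a closed point
# (crux `FInjectiveMacaulayfication`, inputs `hCM` / `h𝔪` of the generic specimen door for `T⁽⁴⁾⁺`)

Support file for crux stmt-ResolutionOfSingularities-15315 (`FrobeniusLadder.FInjectiveMacaulayfication`), chain w45a,
seat res-L1-w45a-stub-4 (res-L1-w45a-plan-1 R12.24 (b): `T4SpecimenDoor` against stub-3's generic door
`SpecimenDoor.fInjectiveMacaulayfication_of_originPointFixable`, binder list of 09:32:10Z). [OURS · L1 W4.5a] — NOT a statement of
the manuscript [claim: Hironaka2017]; AI-written, weaker than expert review.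

`F₁ = Φ − y² − x³`, `F₂ = z² + Φ³ + w⁷ + v⁸ + x¹²` in `k[x,y,z,w,v,Φ] = MvPolynomial (Fin 6) k`, ANY field `k` (no characteristic
hypothesis here). The two specimen-specific inputs of the generic door other than `hoff` (`T4PlusOffStratum.t4Plus_clause_off_origin`)
and `hprime` (`T4PlusPrime`):

* §1 `cm_at_maximal_ofList`, `cm_at_maximal` — the `hCM` binder: at EVERY maximal ideal `Q` of `R = k[X]/(F₁,F₂)` every system of
  parameters of `R_Q` with maximal radical is weakly regular (`R_Q ≅ k[X]_P/(F₁,F₂)` with `k[X]_P` regular local of dimension `6`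
  and `dim R_Q + 2 = 6` by `T4PlusStalkData.ringKrullDim_stalk_add_two`, so `(F₁,F₂)` extends to a system of parameters:
  `CIChartCore.sop_isWeaklyRegular_quotient_ofList`; transport `FiLocusOpenOfAffine.cmClause_of_ringEquiv`);
* §2 `constantCoeff_eq_zero`, `isMaximal_origin` — the `h𝔪` binder: `(x̄₀, …, x̄₅)` is maximal in `R`
  (U7 `QuotientOriginMaximal.isMaximal_span_range_mk_X`, res-D-pv-040).

No definitions, no named facts; glue. [folklore]
-/

-- single-problem summit: the doubled namespace component is forced
set_option linter.dupNamespace false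

noncomputable section

namespace Summit.ResolutionOfSingularities.ResolutionOfSingularities.Theorems.FInjectiveMacaulayfication.T4PlusCM

open MvPolynomial IsLocalRing Literature.AlgebraicGeometry.Resolution
open Summit.ResolutionOfSingularities.ResolutionOfSingularities.Theorems.FInjectiveMacaulayfication
open T4PlusStalkData

variable {k : Type} [Field k]

/-! ## §1 Cohen–Macaulay at every closed point -/

/-- **`T⁽⁴⁾⁺` IS COHEN–MACAULAY AT EVERY CLOSED POINT** (complete intersection of the expected dimension in a regular
local ring), over `Ideal.span s` for the presentation `s = {r | r ∈ [F₁, F₂]}`. [folklore] -/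
theorem cm_at_maximal_ofList (F₁ F₂ : MvPolynomial (Fin 6) k)
    (hF₁ : F₁ = X 5 - X 1 ^ 2 - X 0 ^ 3) (hF₂ : F₂ = X 2 ^ 2 + X 5 ^ 3 + X 3 ^ 7 + X 4 ^ 8 + X 0 ^ 12)
    (s : Set (MvPolynomial (Fin 6) k)) (hs : s = {r : MvPolynomial (Fin 6) k | r ∈ [F₁, F₂]}) :
    ∀ (Q : Ideal (MvPolynomial (Fin 6) k ⧸ Ideal.span s)) [Q.IsMaximal],
      ∀ d : ℕ, ringKrullDim (Localization.AtPrime Q) = d → ∀ sq : Fin d → Localization.AtPrime Q,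
        (Ideal.span (Set.range sq)).radical.IsMaximal →
          RingTheory.Sequence.IsWeaklyRegular (Localization.AtPrime Q) (List.ofFn sq) := by
  subst hs
  intro Q _
  haveI hPmax : (Q.comap (Ideal.Quotient.mk (Ideal.ofList [F₁, F₂]))).IsMaximal :=
    Ideal.comap_isMaximal_of_surjective _ Ideal.Quotient.mk_surjective
  set P : Ideal (MvPolynomial (Fin 6) k) := Q.comap (Ideal.Quotient.mk (Ideal.ofList [F₁, F₂])) with hP_def
  set R := Localization.AtPrime P
  haveI : IsRegularLocalRing R := IsRegularRing.isRegularLocalRing_localization P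
  have hdimR : ringKrullDim R = ((6 : ℕ) : WithBot ℕ∞) := by
    rw [IsLocalization.AtPrime.ringKrullDim_eq_height P R, MvPolynomial.height_eq_of_isMaximal k 6 P]
    rfl
  set gs' : List R := [F₁, F₂].map (algebraMap (MvPolynomial (Fin 6) k) R) with hgs'_def
  have hgsP : ∀ g ∈ [F₁, F₂], g ∈ P := by
    intro g hg
    rw [hP_def, Ideal.mem_comap,
      Ideal.Quotient.eq_zero_iff_mem.mpr (Ideal.subset_span (show g ∈ {r | r ∈ [F₁, F₂]} from hg))]
    exact Q.zero_mem
  have hgs'm : ∀ g ∈ gs', g ∈ maximalIdeal R := by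
    intro g hg
    obtain ⟨g₀, hg₀, rfl⟩ := List.mem_map.mp hg
    rw [← IsLocalization.AtPrime.map_eq_maximalIdeal P R]
    exact Ideal.mem_map_of_mem _ (hgsP g₀ hg₀)
  have hmap : Ideal.ofList gs' = (Ideal.ofList [F₁, F₂]).map (algebraMap (MvPolynomial (Fin 6) k) R) := by
    rw [hgs'_def, Ideal.map_ofList]
  obtain ⟨e₀⟩ := CIFedderAtMaximalIdeal.nonempty_quotLocalizationEquiv (MvPolynomial (Fin 6) k) (Ideal.ofList [F₁, F₂]) Q
  have e₁ : (R ⧸ Ideal.ofList gs') ≃+* Localization.AtPrime Q := (Ideal.quotEquivOfEq hmap).trans e₀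
  have hdimQ := ringKrullDim_stalk_add_two F₁ F₂ hF₁ hF₂ Q
  obtain ⟨e, he⟩ := exists_nat_cast_eq_ringKrullDim (R := Localization.AtPrime Q)
  have hquot : ringKrullDim (R ⧸ Ideal.ofList gs') = (e : WithBot ℕ∞) := by
    rw [ringKrullDim_eq_of_ringEquiv (R := R ⧸ Ideal.ofList gs') (S := Localization.AtPrime Q) e₁, he]
  have hdimR' : ringKrullDim R = ((gs'.length + e : ℕ) : WithBot ℕ∞) := by
    rw [hdimR, ← hdimQ, he, hgs'_def, List.length_map]
    push_cast
    ring
  have hW := CIChartCore.sop_isWeaklyRegular_quotient_ofList gs' hgs'm e hdimR' hquot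
  exact FiLocusOpenOfAffine.cmClause_of_ringEquiv (A := R ⧸ Ideal.ofList gs') (B := Localization.AtPrime Q) e₁ hW

/-- **The `hCM` binder of the generic specimen door for `T⁽⁴⁾⁺`**: Cohen–Macaulayness (inline form) of `(k[X]/(Fs))_Q` at every
maximal `Q`, for a family `Fs : Fin 2 → k[X]` with `Fs 0 = F₁`, `Fs 1 = F₂`. [folklore] -/
theorem cm_at_maximal (Fs : Fin 2 → MvPolynomial (Fin 6) k)
    (hF₀ : Fs 0 = X 5 - X 1 ^ 2 - X 0 ^ 3) (hF₁ : Fs 1 = X 2 ^ 2 + X 5 ^ 3 + X 3 ^ 7 + X 4 ^ 8 + X 0 ^ 12) :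
    ∀ (Q : Ideal (MvPolynomial (Fin 6) k ⧸ Ideal.span (Set.range Fs))) [Q.IsMaximal],
      ∀ d : ℕ, ringKrullDim (Localization.AtPrime Q) = d → ∀ sq : Fin d → Localization.AtPrime Q,
        (Ideal.span (Set.range sq)).radical.IsMaximal →
          RingTheory.Sequence.IsWeaklyRegular (Localization.AtPrime Q) (List.ofFn sq) := by
  have hrange : Set.range Fs = {r : MvPolynomial (Fin 6) k | r ∈ [Fs 0, Fs 1]} := by
    ext r
    simp only [Set.mem_range, Set.mem_setOf_eq, List.mem_cons, List.not_mem_nil, or_false]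
    constructor
    · rintro ⟨i, rfl⟩
      fin_cases i <;> simp
    · rintro (h | h)
      · exact ⟨0, h.symm⟩
      · exact ⟨1, h.symm⟩
  exact cm_at_maximal_ofList (Fs 0) (Fs 1) hF₀ hF₁ (Set.range Fs) hrange

/-! ## §2 The origin is a closed point of `T⁽⁴⁾⁺` -/

/-- Both equations of `T⁽⁴⁾⁺` vanish at the origin. [folklore] -/
theorem constantCoeff_eq_zero (Fs : Fin 2 → MvPolynomial (Fin 6) k)
    (hF₀ : Fs 0 = X 5 - X 1 ^ 2 - X 0 ^ 3) (hF₁ : Fs 1 = X 2 ^ 2 + X 5 ^ 3 + X 3 ^ 7 + X 4 ^ 8 + X 0 ^ 12) :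
    ∀ l : Fin 2, constantCoeff (Fs l) = 0 := by
  intro l
  fin_cases l
  · simp [hF₀, constantCoeff_X]
  · simp [hF₁, constantCoeff_X]

/-- **The `h𝔪` binder of the generic specimen door for `T⁽⁴⁾⁺`**: the origin `(x̄₀, …, x̄₅)` is a maximal ideal of `k[X]/(Fs)`
(U7 `QuotientOriginMaximal.isMaximal_span_range_mk_X`). [folklore] -/
theorem isMaximal_origin (Fs : Fin 2 → MvPolynomial (Fin 6) k)
    (hF₀ : Fs 0 = X 5 - X 1 ^ 2 - X 0 ^ 3) (hF₁ : Fs 1 = X 2 ^ 2 + X 5 ^ 3 + X 3 ^ 7 + X 4 ^ 8 + X 0 ^ 12) :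
    (Ideal.span (Set.range fun i : Fin 6 => Ideal.Quotient.mk (Ideal.span (Set.range Fs)) (MvPolynomial.X i))).IsMaximal :=
  QuotientOriginMaximal.isMaximal_span_range_mk_X k Fs (constantCoeff_eq_zero Fs hF₀ hF₁)

end Summit.ResolutionOfSingularities.ResolutionOfSingularities.Theorems.FInjectiveMacaulayfication.T4PlusCM

end
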